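import Literature.Analysis.FluidPDE.KatoLaiBilinearOperator
import HarnessLib

/-!
# Kato–Lai's bilinear form: the level bounds `H^{m+1} × H^{m+1} → H^m`

Analysis/FluidPDE support file for the energy-method construction of Euler flows in the
periodic cylinder (`Literature.Analysis.FluidPDE.KatoLai1984_periodicCylinderUniformExistence`;
Kato–Lai 1984, §4 (4.2), (4.4): `‖F(v, u)‖_{s-1} ≤ c ‖v‖_{s-1} ‖u‖_s`, `‖(1 − P)F(v, u)‖_s ≤ c‖v‖_s‖u‖_s`).
In lattice form, for smooth torus fields and `m ≥ 2`:

* `exists_latNormSq_convect_le` — `lat_m((W·∇)V) ≤ K lat_m(W) lat_{m+1}(V)` (Leibniz in one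
  direction, `iterate_partialDeriv_convect`, and the three `L²` bounds of convective terms);
* `exists_latNormSq_presBil_le` — `lat_m(presBil U V) ≤ K lat_m(U) lat_{m+1}(V)` (the Helmholtz
  gradient is bounded on `H^m` of the cell, the convective term within is read on the torus);
* `exists_latNormSq_klBil_le` — **`lat_m(klBil U V) ≤ K lat_{m+1}(U) lat_{m+1}(V)`**.

Everything is proved; no named fact and no `sorry` is introduced. Constants are existential.

## References

* T. Kato, C. Y. Lai, J. Funct. Anal. 56 (1984) 15–28, §4. [KatoLai1984]
-/

noncomputable section

open MeasureTheory Set Function Filter Topology TopologicalSpace Finset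
open scoped NNReal ENNReal InnerProductSpace RealInnerProductSpace ContDiff

namespace Literature.Analysis.FluidPDE

open FunctionSpaces FunctionSpaces.Torus UnitAddTorus

/-- Local notation for physical space `ℝ³ = EuclideanSpace ℝ (Fin 3)`. -/
local notation "ℝ³" => EuclideanSpace ℝ (Fin 3)

/-- Local notation for the closed cylinder `{r ≤ 1}`. -/
local notation "𝕂" => closure (SetLike.coe unitCylinder : Set (EuclideanSpace ℝ (Fin 3)))

namespace PeriodicCylinder

variable {L : ℝ} (hL : 0 < L)

/-! ### `L²` norms of finite sums -/

/-- `∫ ‖∑ₐ fₐ‖² ≤ n ∑ₐ ∫ ‖fₐ‖²` for `n` smooth fields. [folklore] -/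
theorem integral_norm_sq_sum_range_le (n : ℕ) {f : ℕ → UnitAddTorus (Fin 3) → ℝ³} (hf : ∀ a, IsSmooth (f a)) :
    ∫ ξ, ‖∑ a ∈ range n, f a ξ‖ ^ 2 ≤ n * ∑ a ∈ range n, ∫ ξ, ‖f a ξ‖ ^ 2 := by
  have hpt : ∀ ξ, ‖∑ a ∈ range n, f a ξ‖ ^ 2 ≤ n * ∑ a ∈ range n, ‖f a ξ‖ ^ 2 := fun ξ => by
    calc ‖∑ a ∈ range n, f a ξ‖ ^ 2 ≤ (∑ a ∈ range n, ‖f a ξ‖) ^ 2 := pow_le_pow_left₀ (norm_nonneg _) (norm_sum_le _ _) 2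
      _ ≤ (range n).card * ∑ a ∈ range n, ‖f a ξ‖ ^ 2 := sq_sum_le_card_mul_sum_sq
      _ = n * ∑ a ∈ range n, ‖f a ξ‖ ^ 2 := by rw [card_range]
  have hint : ∀ a ∈ range n, Integrable (fun ξ => ‖f a ξ‖ ^ 2) volume := fun a _ => (hf a).norm_sq.integrable
  have hI : Integrable (fun ξ => ∑ a ∈ range n, ‖f a ξ‖ ^ 2) volume := integrable_finsetSum _ hint
  calc ∫ ξ, ‖∑ a ∈ range n, f a ξ‖ ^ 2 ≤ ∫ ξ, (n : ℝ) * ∑ a ∈ range n, ‖f a ξ‖ ^ 2 :=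
        integral_mono_of_nonneg (ae_of_all _ fun ξ => sq_nonneg _) (hI.const_mul _) (ae_of_all _ hpt)
    _ = n * ∑ a ∈ range n, ∫ ξ, ‖f a ξ‖ ^ 2 := by rw [integral_const_mul, integral_finsetSum _ hint]

/-! ### The convective term at level `m` -/

/-- **`∫ ‖(A·∇)B‖² ≤ C lat₀(A) lat₃(B)`** (sup on `∇B`); a private copy of the lemma of
`KatoLaiCellUniqueness` (which is not upstream of this file). [folklore] -/
private theorem exists_integral_convect_sq_le_supR : ∃ C : ℝ, 0 ≤ C ∧
    ∀ (A B : UnitAddTorus (Fin 3) → ℝ³), IsSmooth A → IsSmooth B →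
      ∫ ξ, ‖Torus.convect A B ξ‖ ^ 2 ≤ C * Torus.latNormSq 0 A * Torus.latNormSq 3 B := by
  obtain ⟨C, hC0, hC⟩ := Torus.exists_trilinear_sup_right (d := Fin 3) (by simp)
  refine ⟨C ^ 2, by positivity, fun A B hA hB => ?_⟩
  have hc := hA.convect hB
  have h := hC A B (Torus.convect A B) hA hB hc
  have h2 := integral_sq_le_of_self_pairing (by have := Torus.latNormSq_nonneg 0 A; positivity) h
  calc ∫ ξ, ‖Torus.convect A B ξ‖ ^ 2 ≤ (C * Real.sqrt (Torus.latNormSq 0 A) * Real.sqrt (Torus.latNormSq 3 B)) ^ 2 := h2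
    _ = C ^ 2 * Torus.latNormSq 0 A * Torus.latNormSq 3 B := by
        rw [mul_pow, mul_pow, Real.sq_sqrt (Torus.latNormSq_nonneg 0 A), Real.sq_sqrt (Torus.latNormSq_nonneg 3 B)]

/-- **`∫ ‖∂ᵢᵐ((W·∇)V)‖² ≤ K lat_m(W) lat_{m+1}(V)`** for `m ≥ 2`. [cite: KatoLai1984, §4 (4.2)] -/
theorem exists_integral_iterate_convect_sq_le {m : ℕ} (hm : 2 ≤ m) : ∃ K : ℝ, 0 ≤ K ∧
    ∀ (W V : UnitAddTorus (Fin 3) → ℝ³), IsSmooth W → IsSmooth V → ∀ i : Fin 3,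
      ∫ ξ, ‖(Torus.partialDeriv i)^[m] (Torus.convect W V) ξ‖ ^ 2 ≤ K * Torus.latNormSq m W * Torus.latNormSq (m + 1) V := by
  obtain ⟨Csl, hCsl0, hCsl⟩ := exists_integral_convect_sq_le_sup_left
  obtain ⟨Csr, hCsr0, hCsr⟩ := exists_integral_convect_sq_le_supR
  obtain ⟨CL4, hCL40, hCL4⟩ := exists_integral_convect_sq_le_L4
  set q : ℝ := (4 * Real.pi ^ 2) ^ m with hq
  have hq1 : 1 ≤ q := one_le_pow₀ (by nlinarith [Real.pi_gt_three])
  have hq0 : 0 ≤ q := zero_le_one.trans hq1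
  have hSum : ∀ {c : ℝ}, 0 ≤ c → c ≤ Csl + Csr + CL4 → c * q ≤ (Csl + Csr + CL4) * q * q := fun {c} hc hcle => by
    calc c * q = c * q * 1 := (mul_one _).symm
      _ ≤ c * q * q := mul_le_mul_of_nonneg_left hq1 (mul_nonneg hc hq0)
      _ ≤ (Csl + Csr + CL4) * q * q := mul_le_mul_of_nonneg_right (mul_le_mul_of_nonneg_right hcle hq0) hq0
  -- every term is bounded by `B := (Csl + Csr + CL4) q² lat_m W lat_{m+1} V` times `choose²`
  refine ⟨(m + 1) * ∑ a ∈ range (m + 1), (m.choose a : ℝ) ^ 2 * ((Csl + Csr + CL4) * q * q), by positivity, fun W V hW hV i => ?_⟩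
  set T : ℕ → UnitAddTorus (Fin 3) → ℝ³ := fun a ξ =>
    ((m.choose a : ℝ)) • Torus.convect ((Torus.partialDeriv i)^[a] W) ((Torus.partialDeriv i)^[m - a] V) ξ with hT
  have hTs : ∀ a, IsSmooth (T a) := fun a =>
    ((Torus.isSmooth_iterate_partialDeriv hW i a).convect (Torus.isSmooth_iterate_partialDeriv hV i _)).const_smul _
  have hexp : (Torus.partialDeriv i)^[m] (Torus.convect W V) = fun ξ => ∑ a ∈ range (m + 1), T a ξ := by
    rw [Torus.iterate_partialDeriv_convect hW hV i m]
    funext ξ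
    rw [Finset.sum_apply]
    refine sum_congr rfl fun a _ => ?_
    rw [Pi.smul_apply, hT, ← Nat.cast_smul_eq_nsmul ℝ]
  have lW := Torus.latNormSq_nonneg m W
  have lV := Torus.latNormSq_nonneg (m + 1) V
  -- the bound of each term
  have hterm : ∀ a ∈ range (m + 1), ∫ ξ, ‖T a ξ‖ ^ 2 ≤ (m.choose a : ℝ) ^ 2 * ((Csl + Csr + CL4) * q * q) * Torus.latNormSq m W * Torus.latNormSq (m + 1) V := by
    intro a ha
    have ham : a ≤ m := Nat.lt_succ_iff.1 (mem_range.1 ha)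
    have hA := Torus.isSmooth_iterate_partialDeriv hW i a
    have hB := Torus.isSmooth_iterate_partialDeriv hV i (m - a)
    have hI : ∫ ξ, ‖T a ξ‖ ^ 2 = (m.choose a : ℝ) ^ 2 * ∫ ξ, ‖Torus.convect ((Torus.partialDeriv i)^[a] W) ((Torus.partialDeriv i)^[m - a] V) ξ‖ ^ 2 := by
      rw [← integral_const_mul]
      refine integral_congr_ae (ae_of_all _ fun ξ => ?_)
      simp only [hT, norm_smul, mul_pow, Real.norm_eq_abs, sq_abs]
    rw [hI, mul_assoc, mul_assoc]
    refine mul_le_mul_of_nonneg_left ?_ (sq_nonneg _)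
    -- the core: `∫ |convect (∂ᵃW) (∂^{m-a}V)|² ≤ (Csl + Csr + CL4) q² lat_m W lat_{m+1} V`
    have hqa : (4 * Real.pi ^ 2) ^ a ≤ q := pow_le_pow_right₀ (by nlinarith [Real.pi_gt_three]) ham
    have hqma : (4 * Real.pi ^ 2) ^ (m - a) ≤ q := pow_le_pow_right₀ (by nlinarith [Real.pi_gt_three]) (Nat.sub_le m a)
    have key : ∫ ξ, ‖Torus.convect ((Torus.partialDeriv i)^[a] W) ((Torus.partialDeriv i)^[m - a] V) ξ‖ ^ 2 ≤
        (Csl + Csr + CL4) * q * q * (Torus.latNormSq m W * Torus.latNormSq (m + 1) V) := by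
      rcases Nat.eq_zero_or_pos a with ha0 | ha0
      · -- `a = 0`: sup on `W`
        subst ha0
        simp only [Function.iterate_zero, id_eq, Nat.sub_zero]
        have h1 := hCsl W ((Torus.partialDeriv i)^[m] V) hW (Torus.isSmooth_iterate_partialDeriv hV i m)
        have h2 : Torus.latNormSq 1 ((Torus.partialDeriv i)^[m] V) ≤ q * Torus.latNormSq (m + 1) V := by
          have := Torus.latNormSq_iterate_le hV 1 m i; rw [add_comm] at this; exact this
        have h3 : Torus.latNormSq 2 W ≤ Torus.latNormSq m W := Torus.latNormSq_mono hW hm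
        calc _ ≤ Csl * Torus.latNormSq 2 W * Torus.latNormSq 1 ((Torus.partialDeriv i)^[m] V) := h1
          _ ≤ Csl * Torus.latNormSq m W * (q * Torus.latNormSq (m + 1) V) :=
              mul_le_mul (mul_le_mul_of_nonneg_left h3 hCsl0) h2 (Torus.latNormSq_nonneg _ _) (by positivity)
          _ = (Csl * q) * (Torus.latNormSq m W * Torus.latNormSq (m + 1) V) := by ring
          _ ≤ (Csl + Csr + CL4) * q * q * (Torus.latNormSq m W * Torus.latNormSq (m + 1) V) := by
              exact mul_le_mul_of_nonneg_right (hSum hCsl0 (by linarith)) (mul_nonneg lW lV)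
      · rcases lt_or_eq_of_le ham with hlt | heq
        · -- `0 < a < m`: the `L⁴ × L⁴` bound
          have h1 := hCL4 _ _ hA hB
          have h2 : Torus.latNormSq 1 ((Torus.partialDeriv i)^[a] W) ≤ q * Torus.latNormSq m W := by
            have h := Torus.latNormSq_iterate_le hW 1 a i
            have h' : Torus.latNormSq (1 + a) W ≤ Torus.latNormSq m W := Torus.latNormSq_mono hW (by omega)
            calc _ ≤ (4 * Real.pi ^ 2) ^ a * Torus.latNormSq (1 + a) W := h
              _ ≤ q * Torus.latNormSq m W := mul_le_mul hqa h' (Torus.latNormSq_nonneg _ _) (by positivity)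
          have h3 : Torus.latNormSq 2 ((Torus.partialDeriv i)^[m - a] V) ≤ q * Torus.latNormSq (m + 1) V := by
            have h := Torus.latNormSq_iterate_le hV 2 (m - a) i
            have h' : Torus.latNormSq (2 + (m - a)) V ≤ Torus.latNormSq (m + 1) V := Torus.latNormSq_mono hV (by omega)
            calc _ ≤ (4 * Real.pi ^ 2) ^ (m - a) * Torus.latNormSq (2 + (m - a)) V := h
              _ ≤ q * Torus.latNormSq (m + 1) V := mul_le_mul hqma h' (Torus.latNormSq_nonneg _ _) (by positivity)
          calc _ ≤ CL4 * Torus.latNormSq 1 ((Torus.partialDeriv i)^[a] W) * Torus.latNormSq 2 ((Torus.partialDeriv i)^[m - a] V) := h1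
            _ ≤ CL4 * (q * Torus.latNormSq m W) * (q * Torus.latNormSq (m + 1) V) :=
                mul_le_mul (mul_le_mul_of_nonneg_left h2 hCL40) h3 (Torus.latNormSq_nonneg _ _) (by positivity)
            _ = (CL4 * q * q) * (Torus.latNormSq m W * Torus.latNormSq (m + 1) V) := by ring
            _ ≤ (Csl + Csr + CL4) * q * q * (Torus.latNormSq m W * Torus.latNormSq (m + 1) V) := by
                refine mul_le_mul_of_nonneg_right ?_ (mul_nonneg lW lV)
                exact mul_le_mul_of_nonneg_right (mul_le_mul_of_nonneg_right (by linarith) hq0) hq0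
        · -- `a = m`: sup on `∇V`
          subst heq
          simp only [Nat.sub_self, Function.iterate_zero, id_eq]
          have h1 := hCsr _ V hA hV
          have h2 : Torus.latNormSq 0 ((Torus.partialDeriv i)^[a] W) ≤ q * Torus.latNormSq a W := by
            have := Torus.latNormSq_iterate_le hW 0 a i; rw [zero_add] at this; exact this
          have h3 : Torus.latNormSq 3 V ≤ Torus.latNormSq (a + 1) V := Torus.latNormSq_mono hV (by omega)
          calc _ ≤ Csr * Torus.latNormSq 0 ((Torus.partialDeriv i)^[a] W) * Torus.latNormSq 3 V := h1
            _ ≤ Csr * (q * Torus.latNormSq a W) * Torus.latNormSq (a + 1) V :=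
                mul_le_mul (mul_le_mul_of_nonneg_left h2 hCsr0) h3 (Torus.latNormSq_nonneg _ _) (by positivity)
            _ = (Csr * q) * (Torus.latNormSq a W * Torus.latNormSq (a + 1) V) := by ring
            _ ≤ (Csl + Csr + CL4) * q * q * (Torus.latNormSq a W * Torus.latNormSq (a + 1) V) := by
                exact mul_le_mul_of_nonneg_right (hSum hCsr0 (by linarith)) (mul_nonneg lW lV)
    calc _ ≤ (Csl + Csr + CL4) * q * q * (Torus.latNormSq m W * Torus.latNormSq (m + 1) V) := key
      _ = _ := by ring
  -- sum up
  rw [hexp]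
  calc ∫ ξ, ‖∑ a ∈ range (m + 1), T a ξ‖ ^ 2 ≤ (m + 1 : ℕ) * ∑ a ∈ range (m + 1), ∫ ξ, ‖T a ξ‖ ^ 2 :=
        integral_norm_sq_sum_range_le (m + 1) hTs
    _ ≤ (m + 1 : ℕ) * ∑ a ∈ range (m + 1), (m.choose a : ℝ) ^ 2 * ((Csl + Csr + CL4) * q * q) * Torus.latNormSq m W * Torus.latNormSq (m + 1) V :=
        mul_le_mul_of_nonneg_left (sum_le_sum hterm) (by positivity)
    _ = _ := by push_cast; rw [← sum_mul, ← sum_mul]; ring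

/-- **`lat_m((W·∇)V) ≤ K lat_m(W) lat_{m+1}(V)`** for `m ≥ 2`. [cite: KatoLai1984, §4 (4.2)] -/
theorem exists_latNormSq_convect_le {m : ℕ} (hm : 2 ≤ m) : ∃ K : ℝ, 0 ≤ K ∧
    ∀ (W V : UnitAddTorus (Fin 3) → ℝ³), IsSmooth W → IsSmooth V →
      Torus.latNormSq m (Torus.convect W V) ≤ K * Torus.latNormSq m W * Torus.latNormSq (m + 1) V := by
  obtain ⟨Csl, hCsl0, hCsl⟩ := exists_integral_convect_sq_le_sup_left
  obtain ⟨K₁, hK₁0, hK₁⟩ := exists_integral_iterate_convect_sq_le hm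
  refine ⟨4 ^ m * (Csl + 3 * K₁), by positivity, fun W V hW hV => ?_⟩
  have hZ := hW.convect hV
  have h0 := Torus.tsum_weight_mul_norm_sq_le hZ m
  have hc : ((Fintype.card (Fin 3) : ℝ) + 1) = 4 := by norm_num
  rw [hc] at h0
  have lW := Torus.latNormSq_nonneg m W
  have lV := Torus.latNormSq_nonneg (m + 1) V
  have h1 : ∫ ξ, ‖Torus.convect W V ξ‖ ^ 2 ≤ Csl * Torus.latNormSq m W * Torus.latNormSq (m + 1) V := by
    calc _ ≤ Csl * Torus.latNormSq 2 W * Torus.latNormSq 1 V := hCsl W V hW hV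
      _ ≤ Csl * Torus.latNormSq m W * Torus.latNormSq (m + 1) V :=
          mul_le_mul (mul_le_mul_of_nonneg_left (Torus.latNormSq_mono hW hm) hCsl0) (Torus.latNormSq_mono hV (by omega))
            (Torus.latNormSq_nonneg _ _) (by positivity)
  have h2 : ∑ i, ∫ ξ, ‖Torus.wordDeriv (List.replicate m i) (Torus.convect W V) ξ‖ ^ 2 ≤ 3 * (K₁ * Torus.latNormSq m W * Torus.latNormSq (m + 1) V) := by
    calc _ ≤ ∑ _i : Fin 3, K₁ * Torus.latNormSq m W * Torus.latNormSq (m + 1) V := sum_le_sum fun i _ => by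
          rw [Torus.wordDeriv_replicate]; exact hK₁ W V hW hV i
      _ = _ := by rw [sum_const, card_univ, Fintype.card_fin]; simp
  unfold Torus.latNormSq
  calc _ ≤ 4 ^ m * ((∫ ξ, ‖Torus.convect W V ξ‖ ^ 2) + ∑ i, ∫ ξ, ‖Torus.wordDeriv (List.replicate m i) (Torus.convect W V) ξ‖ ^ 2) := h0
    _ ≤ 4 ^ m * (Csl * Torus.latNormSq m W * Torus.latNormSq (m + 1) V + 3 * (K₁ * Torus.latNormSq m W * Torus.latNormSq (m + 1) V)) :=
        mul_le_mul_of_nonneg_left (add_le_add h1 h2) (by positivity)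
    _ = _ := by unfold Torus.latNormSq; ring

/-! ### Lattice energies of sums and multiples -/

/-- `lat_m(f + g) ≤ 2 lat_m f + 2 lat_m g`. [folklore] -/
theorem latNormSq_add_le {f g : UnitAddTorus (Fin 3) → ℝ³} (hf : IsSmooth f) (hg : IsSmooth g) (m : ℕ) :
    Torus.latNormSq m (fun ξ => f ξ + g ξ) ≤ 2 * Torus.latNormSq m f + 2 * Torus.latNormSq m g := by
  have hs : IsSmooth (fun ξ => f ξ + g ξ) := hf.add hg
  unfold Torus.latNormSq
  rw [← tsum_mul_left, ← tsum_mul_left, ← ((Torus.summable_latWeight hf m).mul_left 2).tsum_add ((Torus.summable_latWeight hg m).mul_left 2)]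
  refine (Torus.summable_latWeight hs m).tsum_le_tsum (fun k => ?_)
    (((Torus.summable_latWeight hf m).mul_left 2).add ((Torus.summable_latWeight hg m).mul_left 2))
  have hw : 0 ≤ (1 + freqNormSq k) ^ m := pow_nonneg (by linarith [freqNormSq_nonneg k]) m
  have e : (EuclideanSpace.complexify ∘ fun ξ => f ξ + g ξ) = (EuclideanSpace.complexify ∘ f) + (EuclideanSpace.complexify ∘ g) := by
    funext y; simp
  rw [e, mFourierCoeff_add (integrable_complexify_comp hf.integrable) (integrable_complexify_comp hg.integrable)]
  set a := ‖mFourierCoeff (EuclideanSpace.complexify ∘ f) k‖ with ha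
  set b := ‖mFourierCoeff (EuclideanSpace.complexify ∘ g) k‖ with hb
  have h := norm_add_le (mFourierCoeff (EuclideanSpace.complexify ∘ f) k) (mFourierCoeff (EuclideanSpace.complexify ∘ g) k)
  have h2 : ‖mFourierCoeff (EuclideanSpace.complexify ∘ f) k + mFourierCoeff (EuclideanSpace.complexify ∘ g) k‖ ^ 2 ≤ 2 * a ^ 2 + 2 * b ^ 2 := by
    calc _ ≤ (a + b) ^ 2 := pow_le_pow_left₀ (norm_nonneg _) h 2
      _ ≤ 2 * a ^ 2 + 2 * b ^ 2 := by nlinarith [sq_nonneg (a - b)]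
  calc (1 + freqNormSq k) ^ m * ‖mFourierCoeff (EuclideanSpace.complexify ∘ f) k + mFourierCoeff (EuclideanSpace.complexify ∘ g) k‖ ^ 2
      ≤ (1 + freqNormSq k) ^ m * (2 * a ^ 2 + 2 * b ^ 2) := mul_le_mul_of_nonneg_left h2 hw
    _ = _ := by ring

/-- `lat_m(c f) = c² lat_m f`. [folklore] -/
theorem latNormSq_smul (c : ℝ) (f : UnitAddTorus (Fin 3) → ℝ³) (m : ℕ) :
    Torus.latNormSq m (fun ξ => c • f ξ) = c ^ 2 * Torus.latNormSq m f := by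
  unfold Torus.latNormSq
  rw [← tsum_mul_left]
  refine tsum_congr fun k => ?_
  have e : (EuclideanSpace.complexify ∘ fun ξ => c • f ξ) = (c : ℂ) • (EuclideanSpace.complexify ∘ f) := by
    funext y
    simp only [Function.comp_apply, Pi.smul_apply, LinearIsometry.map_smul]
    exact RCLike.real_smul_eq_coe_smul c _
  rw [e, mFourierCoeff_const_smul, norm_smul, Complex.norm_real, Real.norm_eq_abs, mul_pow, sq_abs]
  ring

/-! ### The pressure form at level `m` -/

/-- **`lat_m(presBil U V) ≤ K lat_m(U) lat_{m+1}(V)`** for `m ≥ 2`. [cite: KatoLai1984, §4 (4.4)] -/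
theorem exists_latNormSq_presBil_le {m : ℕ} (hm : 2 ≤ m) : ∃ K : ℝ, 0 ≤ K ∧
    ∀ (U V : UnitAddTorus (Fin 3) → ℝ³) (hU : IsSmooth U) (hV : IsSmooth V),
      Torus.latNormSq m (presBil hL hU hV) ≤ K * Torus.latNormSq m U * Torus.latNormSq (m + 1) V := by
  obtain ⟨Cr, hCr0, hCr⟩ := exists_latNormSq_torusRep_le hL m
  obtain ⟨Cr1, hCr10, hCr1⟩ := exists_latNormSq_torusRep_le hL (m + 1)
  obtain ⟨n, hn⟩ : ∃ n : ℕ, m = n + 1 := ⟨m - 1, by omega⟩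
  obtain ⟨CQ, hCQ⟩ := exists_leray_bound hL n
  obtain ⟨CP, hCP⟩ := exists_leray_bound hL m
  obtain ⟨CE, hCE0, hCE⟩ := exists_toReal_eSobolevDomainNorm_fromTorus_sq_le hL m
  obtain ⟨CE1, hCE10, hCE1⟩ := exists_toReal_eSobolevDomainNorm_fromTorus_sq_le hL (m + 1)
  obtain ⟨Kc, hKc0, hKc⟩ := exists_latNormSq_convect_le hm
  obtain ⟨CW, hCW0, hCW⟩ := exists_latNormSq_transportRep_le hL (m := m) (by omega)
  refine ⟨Cr * (CQ : ℝ) ^ 2 * CE * Kc * CW * (Cr1 * (1 + CP : ℝ) ^ 2 * CE1), by positivity, fun U V hU hV => ?_⟩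
  have hu := isSmoothPeriodic_fromTorus hL.ne' hU
  have hv := isSmoothPeriodic_fromTorus hL.ne' hV
  have hwu := isSmoothPeriodic_lerayPart hL hu
  have hwv := isSmoothPeriodic_lerayPart hL hv
  have hb := isSmoothPeriodic_cylDeriv hwu hwv
  have hq := isSmoothPeriodic_qGrad hL hb
  set A := transportRep L hL hU with hAdef
  set B := torusRep L (lerayPart hL hv) with hBdef
  have hAs : IsSmooth A := isSmooth_transportRep hL hU
  have hBs : IsSmooth B := isSmooth_torusRep hwv
  have lU := Torus.latNormSq_nonneg m U
  have lV := Torus.latNormSq_nonneg (m + 1) V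
  -- (1) `lat_m(presBil) ≤ Cr eSob_m(qGrad b)²`
  have h1 : Torus.latNormSq m (presBil hL hU hV) ≤ Cr * (eSobolevDomainNorm m 2 (cylinderCell L) volume (qGrad hL hb)).toReal ^ 2 := hCr _ hq
  -- (2) `eSob_m(qGrad b) ≤ CQ eSob_m(b)`
  have hfinb : eSobolevDomainNorm m 2 (cylinderCell L) volume (cylDeriv (lerayPart hL hu) (lerayPart hL hv)) < ⊤ :=
    eSobolevDomainNorm_lt_top_of_isSmoothPeriodic L m hb.smooth
  have h2 : (eSobolevDomainNorm m 2 (cylinderCell L) volume (qGrad hL hb)).toReal ≤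
      CQ * (eSobolevDomainNorm m 2 (cylinderCell L) volume (cylDeriv (lerayPart hL hu) (lerayPart hL hv))).toReal := by
    have h := (hCQ hb).1
    rw [← hn] at h
    have := ENNReal.toReal_mono (ENNReal.mul_ne_top ENNReal.coe_ne_top hfinb.ne) h
    rwa [ENNReal.toReal_mul, ENNReal.coe_toReal] at this
  -- (3) `eSob_m(b)² ≤ CE lat_m(convect A B)`, reading `b` on the torus
  have h3 : (eSobolevDomainNorm m 2 (cylinderCell L) volume (cylDeriv (lerayPart hL hu) (lerayPart hL hv))).toReal ^ 2 ≤
      CE * Torus.latNormSq m (Torus.convect A B) := by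
    have hcongr : eSobolevDomainNorm m 2 (cylinderCell L) volume (cylDeriv (lerayPart hL hu) (lerayPart hL hv)) =
        eSobolevDomainNorm m 2 (cylinderCell L) volume (fromTorus L (Torus.convect A B)) :=
      SobolevApprox.eSobolevDomainNorm_congr (Ω := cylinderCell L) (p := 2) (μ := volume) fun x hx =>
        cylDeriv_eq_fromTorus_convect hL hwu hwv (cylinderCell_le_unitCylinder L hx)
    rw [hcongr]
    exact hCE _ (hAs.convect hBs)
  -- (4) `lat_m(convect A B) ≤ Kc lat_m A lat_{m+1} B ≤ Kc CW lat_m U · Cr1 (1+CP)² CE1 lat_{m+1} V`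
  have h4 : Torus.latNormSq m (Torus.convect A B) ≤ Kc * (CW * Torus.latNormSq m U) * (Cr1 * (1 + CP : ℝ) ^ 2 * CE1 * Torus.latNormSq (m + 1) V) := by
    have hA1 : Torus.latNormSq m A ≤ CW * Torus.latNormSq m U := hCW U hU
    have hfinv : eSobolevDomainNorm (m + 1) 2 (cylinderCell L) volume (fromTorus L V) < ⊤ :=
      eSobolevDomainNorm_lt_top_of_isSmoothPeriodic L (m + 1) hv.smooth
    have hPv : (eSobolevDomainNorm (m + 1) 2 (cylinderCell L) volume (lerayPart hL hv)).toReal ≤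
        (1 + CP) * (eSobolevDomainNorm (m + 1) 2 (cylinderCell L) volume (fromTorus L V)).toReal := by
      have := ENNReal.toReal_mono (ENNReal.mul_ne_top ENNReal.coe_ne_top hfinv.ne) (hCP hv).2
      rwa [ENNReal.toReal_mul, ENNReal.coe_toReal, NNReal.coe_add, NNReal.coe_one] at this
    have hB1 : Torus.latNormSq (m + 1) B ≤ Cr1 * (1 + CP : ℝ) ^ 2 * CE1 * Torus.latNormSq (m + 1) V := by
      calc Torus.latNormSq (m + 1) B ≤ Cr1 * (eSobolevDomainNorm (m + 1) 2 (cylinderCell L) volume (lerayPart hL hv)).toReal ^ 2 := hCr1 _ hwv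
        _ ≤ Cr1 * ((1 + CP) * (eSobolevDomainNorm (m + 1) 2 (cylinderCell L) volume (fromTorus L V)).toReal) ^ 2 :=
            mul_le_mul_of_nonneg_left (pow_le_pow_left₀ ENNReal.toReal_nonneg hPv 2) hCr10
        _ = Cr1 * (1 + CP : ℝ) ^ 2 * (eSobolevDomainNorm (m + 1) 2 (cylinderCell L) volume (fromTorus L V)).toReal ^ 2 := by ring
        _ ≤ Cr1 * (1 + CP : ℝ) ^ 2 * (CE1 * Torus.latNormSq (m + 1) V) := mul_le_mul_of_nonneg_left (hCE1 V hV) (by positivity)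
        _ = _ := by ring
    calc Torus.latNormSq m (Torus.convect A B) ≤ Kc * Torus.latNormSq m A * Torus.latNormSq (m + 1) B := hKc A B hAs hBs
      _ ≤ Kc * (CW * Torus.latNormSq m U) * (Cr1 * (1 + CP : ℝ) ^ 2 * CE1 * Torus.latNormSq (m + 1) V) :=
          mul_le_mul (mul_le_mul_of_nonneg_left hA1 hKc0) hB1 (Torus.latNormSq_nonneg _ _) (by positivity)
  -- assemble
  have hCQ0 : (0 : ℝ) ≤ CQ := CQ.2
  calc Torus.latNormSq m (presBil hL hU hV) ≤ Cr * (eSobolevDomainNorm m 2 (cylinderCell L) volume (qGrad hL hb)).toReal ^ 2 := h1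
    _ ≤ Cr * (CQ * (eSobolevDomainNorm m 2 (cylinderCell L) volume (cylDeriv (lerayPart hL hu) (lerayPart hL hv))).toReal) ^ 2 :=
        mul_le_mul_of_nonneg_left (pow_le_pow_left₀ ENNReal.toReal_nonneg h2 2) hCr0
    _ = Cr * (CQ : ℝ) ^ 2 * (eSobolevDomainNorm m 2 (cylinderCell L) volume (cylDeriv (lerayPart hL hu) (lerayPart hL hv))).toReal ^ 2 := by ring
    _ ≤ Cr * (CQ : ℝ) ^ 2 * (CE * Torus.latNormSq m (Torus.convect A B)) := mul_le_mul_of_nonneg_left h3 (by positivity)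
    _ ≤ Cr * (CQ : ℝ) ^ 2 * (CE * (Kc * (CW * Torus.latNormSq m U) * (Cr1 * (1 + CP : ℝ) ^ 2 * CE1 * Torus.latNormSq (m + 1) V))) :=
        mul_le_mul_of_nonneg_left (mul_le_mul_of_nonneg_left h4 hCE0) (by positivity)
    _ = _ := by ring

/-! ### Kato–Lai's bilinear form at level `m` -/

/-- **`lat_m(klBil U V) ≤ K lat_{m+1}(U) lat_{m+1}(V)`** for `m ≥ 2`. [cite: KatoLai1984, §4 (4.2), (4.4)] -/
theorem exists_latNormSq_klBil_le {m : ℕ} (hm : 2 ≤ m) : ∃ K : ℝ, 0 ≤ K ∧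
    ∀ (U V : UnitAddTorus (Fin 3) → ℝ³) (hU : IsSmooth U) (hV : IsSmooth V),
      Torus.latNormSq m (klBil hL hU hV) ≤ K * Torus.latNormSq (m + 1) U * Torus.latNormSq (m + 1) V := by
  obtain ⟨Kc, hKc0, hKc⟩ := exists_latNormSq_convect_le hm
  obtain ⟨CW, hCW0, hCW⟩ := exists_latNormSq_transportRep_le hL (m := m) (by omega)
  obtain ⟨Kp, hKp0, hKp⟩ := exists_latNormSq_presBil_le hL hm
  refine ⟨2 * (Kc * CW) + 2 * ((2 : ℝ)⁻¹ ^ 2 * (2 * Kp + 2 * Kp)), by positivity, fun U V hU hV => ?_⟩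
  have hT := (isSmooth_transportRep hL hU).convect hV
  have hp1 := isSmooth_presBil hL hU hV
  have hp2 := isSmooth_presBil hL hV hU
  have hps : IsSmooth (fun ξ => presBil hL hU hV ξ + presBil hL hV hU ξ) := hp1.add hp2
  have hneg : IsSmooth (fun ξ => -((2 : ℝ)⁻¹ • (presBil hL hU hV ξ + presBil hL hV hU ξ))) := (hps.const_smul _).neg
  have lU := Torus.latNormSq_nonneg (m + 1) U
  have lV := Torus.latNormSq_nonneg (m + 1) V
  have hmU : Torus.latNormSq m U ≤ Torus.latNormSq (m + 1) U := Torus.latNormSq_mono hU (by omega)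
  have hmV : Torus.latNormSq m V ≤ Torus.latNormSq (m + 1) V := Torus.latNormSq_mono hV (by omega)
  -- the transport part
  have h1 : Torus.latNormSq m (Torus.convect (transportRep L hL hU) V) ≤ Kc * CW * Torus.latNormSq (m + 1) U * Torus.latNormSq (m + 1) V := by
    calc _ ≤ Kc * Torus.latNormSq m (transportRep L hL hU) * Torus.latNormSq (m + 1) V := hKc _ _ (isSmooth_transportRep hL hU) hV
      _ ≤ Kc * (CW * Torus.latNormSq (m + 1) U) * Torus.latNormSq (m + 1) V :=
          mul_le_mul_of_nonneg_right (mul_le_mul_of_nonneg_left ((hCW U hU).trans (mul_le_mul_of_nonneg_left hmU hCW0)) hKc0) lV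
      _ = _ := by ring
  -- the pressure part
  have h2 : Torus.latNormSq m (fun ξ => -((2 : ℝ)⁻¹ • (presBil hL hU hV ξ + presBil hL hV hU ξ))) ≤
      (2 : ℝ)⁻¹ ^ 2 * (2 * Kp + 2 * Kp) * Torus.latNormSq (m + 1) U * Torus.latNormSq (m + 1) V := by
    have e : (fun ξ => -((2 : ℝ)⁻¹ • (presBil hL hU hV ξ + presBil hL hV hU ξ))) = fun ξ => (-(2 : ℝ)⁻¹) • (presBil hL hU hV ξ + presBil hL hV hU ξ) := by
      funext ξ; rw [neg_smul]
    rw [e, latNormSq_smul, neg_sq]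
    have hq1 := hKp U V hU hV
    have hq2 := hKp V U hV hU
    have hs := latNormSq_add_le hp1 hp2 m
    have hb1 : Torus.latNormSq m (presBil hL hU hV) ≤ Kp * Torus.latNormSq (m + 1) U * Torus.latNormSq (m + 1) V :=
      hq1.trans (mul_le_mul_of_nonneg_right (mul_le_mul_of_nonneg_left hmU hKp0) lV)
    have hb2 : Torus.latNormSq m (presBil hL hV hU) ≤ Kp * Torus.latNormSq (m + 1) U * Torus.latNormSq (m + 1) V := by
      calc _ ≤ Kp * Torus.latNormSq m V * Torus.latNormSq (m + 1) U := hq2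
        _ ≤ Kp * Torus.latNormSq (m + 1) V * Torus.latNormSq (m + 1) U := mul_le_mul_of_nonneg_right (mul_le_mul_of_nonneg_left hmV hKp0) lU
        _ = _ := by ring
    nlinarith
  -- assemble: `klBil = convect + (−½ (p₁ + p₂))`
  have e : klBil hL hU hV = fun ξ => Torus.convect (transportRep L hL hU) V ξ + -((2 : ℝ)⁻¹ • (presBil hL hU hV ξ + presBil hL hV hU ξ)) := by
    funext ξ; rw [klBil, sub_eq_add_neg]
  rw [e]
  calc _ ≤ 2 * Torus.latNormSq m (Torus.convect (transportRep L hL hU) V) +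
        2 * Torus.latNormSq m (fun ξ => -((2 : ℝ)⁻¹ • (presBil hL hU hV ξ + presBil hL hV hU ξ))) := latNormSq_add_le hT hneg m
    _ ≤ 2 * (Kc * CW * Torus.latNormSq (m + 1) U * Torus.latNormSq (m + 1) V) +
        2 * ((2 : ℝ)⁻¹ ^ 2 * (2 * Kp + 2 * Kp) * Torus.latNormSq (m + 1) U * Torus.latNormSq (m + 1) V) := by linarith
    _ = _ := by ring


end PeriodicCylinder

end Literature.Analysis.FluidPDE
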